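import Summits.ABC.StewartYu.PadicG3TwoThirdClass
import Summits.ABC.StewartYu.PadicG3TwoValues
import HarnessLib

/-!
# Cell abc-stewartyu, Gen-3 frame at `p = 2` (crux `Y07Two`, stmt-ABC-19659), layer F5 brick (5): DENOMINATORS AND
# SIZES of the triadic class sums `thirdVec` at a third point (the `D` and `M` of the multicubic Liouville step)

`Summits/ABC/StewartYu/PadicG3TwoThirdSizes.lean` — cell `abc-stewartyu` (HOME `run/shared/lean/pub/abc-stewartyu/`),
route `PadicPrimesKummerThird`, seat p5 (g3) (F5 bricks (5)–(7) of the F-two lead's memo-09 §13; brick (6) is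
`PadicG3TwoThirdReindex`).  Theorems on `TwoSetup` (one `abbrev` for the quotient box); no named fact.  Twin of
p3-g5's `PadicG3TwoValues.exists_int_clear_mul_g3φ` with `qPart3 κ s = ∏ₖ allₖ^{⌊κₖ s/3⌋}` in place of `zmon`.

For p3-g5's class sums (`PadicG3TwoThirdClass.thirdVec`)
`thirdVec B p τ s r = ∑_{i : res3 κᵢ s = r} pᵢ·((Hasse_{t₀} Rᵢ)(s/3)·∏ⱼ zγⱼ(i)^{tⱼ}·qPart3 κᵢ s)` the three factors
are cleared separately, exactly as at the integer points: the `Y₀`-weight AT THE THIRD POINT by pointwise data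
`den₃·(Hasse_{t₀} Rᵢ)(s/3) = z₀ ∈ ℤ`, `|z₀| ≤ M₃` (in the assembly: `den₃ = den₀(I+1)(s,τ)` of the NEXT level's
rescaled basis `Rᵢ ∘ (Y₀/3)`, by `PadicG3TwoThirdReindex.eval_hasseDeriv_comp_third`), the directional monomial by
`b_θ^{|t|}` (`bθ_pow_mul_zγpow`), and `qPart3` by `MonomialDen.monDen` of the quotient box `thirdBox`
(`|⌊κₖ s/3⌋| ≤ Dₖ|s|/3 + 1`).  Results: `exists_int_clear_mul_thirdVec` (common denominator
`D = den₃·|b_θ|^{|t|}·monDen(all, thirdBox s)`, `|D·thirdVec r| ≤ #B_r·P·M₃·Xb^{|t|}·monDen²`) and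
`sum_abs_thirdVec_le` (`∑ᵣ |thirdVec r| ≤ #B·P·M₃·Xb^{|t|}·monDen²`, the classes partition `B`) — the `hden`/`hcM`
inputs of `PadicG3TwoThirdLiouville.thirdVec_eq_zero_of_norm_lt` / `PadicG3TwoThirdSmall.thirdVec_eq_zero_of_zeros`.

WHAT THIS IS NOT: no Liouville, no re-indexing, no record numbers; no crux moves.

References: K. Yu, Acta Math. 211 (2013), (5.35)–(5.39) at the points `s/q`, Lemma 5.4; Yu. V. Nesterenko, LNM
1819 (2003), §3.2.
-/

noncomputable section

open Finset Polynomial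
open Literature.NumberTheory.Transcendental
open Literature.NumberTheory.Transcendental.CW77.Setup (Tau tauNorm)

namespace Summit.ABC.StewartYu

namespace TwoSetup

variable (S : TwoSetup) {ι : Type*} (R : ι → ℚ[X]) (u : ι → Fin S.d → ℤ) (uθ : ι → ℤ)

/-! ### The quotient box -/

/-- The exponent box of the quotients `⌊κₖ s/3⌋` at the point `s`: `thirdBoxₖ = Dₖ·|s|/3 + 1`. [folklore] -/
abbrev thirdBox (Dbox : Fin S.d → ℕ) (Dθ : ℕ) (s : ℤ) : Fin (S.d + 1) → ℕ :=
  fun k => S.boxExp Dbox Dθ s k / 3 + 1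

/-- `(snoc u u_θ)ₖ · s = allExpₖ(u, u_θ, s)`. [folklore] -/
theorem snoc_mul_eq_allExp (v : Fin S.d → ℤ) (vθ : ℤ) (s : ℤ) (k : Fin (S.d + 1)) :
    (Fin.snoc v vθ : Fin (S.d + 1) → ℤ) k * s = S.allExp v vθ s k := by
  unfold allExp
  refine Fin.lastCases ?_ (fun j => ?_) k
  · simp only [Fin.snoc_last]
  · simp only [Fin.snoc_castSucc]

/-- `|⌊e/3⌋| ≤ |e|/3 + 1` for integers. [folklore] -/
theorem abs_ediv_three_le (e : ℤ) : |e / 3| ≤ |e| / 3 + 1 := by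
  rw [abs_le]
  rcases le_or_gt 0 e with he | he
  · rw [abs_of_nonneg he]; constructor <;> omega
  · rw [abs_of_neg he]; constructor <;> omega

/-- In the box, `|⌊κₖ s/3⌋| ≤ thirdBoxₖ`. [folklore] -/
theorem abs_quot_le_thirdBox {Dbox : Fin S.d → ℕ} {Dθ : ℕ} (i : ι)
    (hu : ∀ j, |u i j| ≤ (Dbox j : ℤ)) (huθ : |uθ i| ≤ (Dθ : ℤ)) (s : ℤ) (k : Fin (S.d + 1)) :
    |(Fin.snoc (u i) (uθ i) : Fin (S.d + 1) → ℤ) k * s / 3| ≤ (S.thirdBox Dbox Dθ s k : ℤ) := by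
  have h1 := abs_ediv_three_le ((Fin.snoc (u i) (uθ i) : Fin (S.d + 1) → ℤ) k * s)
  have h2 : |(Fin.snoc (u i) (uθ i) : Fin (S.d + 1) → ℤ) k * s| ≤ (S.boxExp Dbox Dθ s k : ℤ) := by
    rw [S.snoc_mul_eq_allExp]; exact S.abs_allExp_le hu huθ s k
  unfold thirdBox
  push_cast
  have h3 : |(Fin.snoc (u i) (uθ i) : Fin (S.d + 1) → ℤ) k * s| / 3 ≤ (S.boxExp Dbox Dθ s k : ℤ) / 3 :=
    Int.ediv_le_ediv (by norm_num) h2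
  omega

/-- **`qPart3` cleared**: `monDen(all, thirdBox s)·qPart3 κᵢ s ∈ ℤ` with `|·| ≤ monDen²`.
[cite: Nesterenko2003, §3.2; shape only] -/
theorem exists_int_monDen_mul_qPart3 {Dbox : Fin S.d → ℕ} {Dθ : ℕ} (i : ι)
    (hu : ∀ j, |u i j| ≤ (Dbox j : ℤ)) (huθ : |uθ i| ≤ (Dθ : ℤ)) (s : ℤ) :
    ∃ z : ℤ, ((MonomialDen.monDen S.toQ.all (S.thirdBox Dbox Dθ s) : ℕ) : ℚ) *
        S.qPart3 (Fin.snoc (u i) (uθ i)) s = z ∧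
      |z| ≤ ((MonomialDen.monDen S.toQ.all (S.thirdBox Dbox Dθ s) : ℤ)) ^ 2 := by
  unfold qPart3
  exact MonomialDen.exists_int_monDen_mul_prod_zpow S.toQ.all S.toQ.all_ne _ _
    (S.abs_quot_le_thirdBox u uθ i hu huθ s)

/-! ### One coefficient and the class sums cleared -/

/-- **One coefficient of a class sum cleared**: with `den₃·(Hasse_{t₀} Rᵢ)(s/3) = z₀ ∈ ℤ`, `|z₀| ≤ M₃`,
`|𝔛ⱼ(i)| ≤ Xb` and the box, `D·[(Hasse_{t₀} Rᵢ)(s/3)·∏ zγⱼ^{tⱼ}·qPart3 κᵢ s] ∈ ℤ`, `|·| ≤ M₃·Xb^{|t|}·monDen²`,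
`D = den₃·|b_θ|^{|t|}·monDen(all, thirdBox s)`. [cite: Yu2013, (5.35); shape only] -/
theorem exists_int_clear_mul_third_coef {Dbox : Fin S.d → ℕ} {Dθ : ℕ} (i : ι)
    (hu : ∀ j, |u i j| ≤ (Dbox j : ℤ)) (huθ : |uθ i| ≤ (Dθ : ℤ)) (τ : Tau S.d) (s : ℤ)
    {den₃ : ℕ} {M₃ : ℤ}
    (hR : ∃ z₀ : ℤ, (den₃ : ℚ) * (hasseDeriv τ.1 (R i)).eval ((s : ℚ) / 3) = z₀ ∧ |z₀| ≤ M₃)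
    {Xb : ℤ} (hX : ∀ j, |S.dirScalar (u i) (uθ i) j| ≤ Xb) :
    ∃ z : ℤ, ((den₃ * S.bθ.natAbs ^ (∑ j, τ.2 j) *
        MonomialDen.monDen S.toQ.all (S.thirdBox Dbox Dθ s) : ℕ) : ℚ) *
        ((hasseDeriv τ.1 (R i)).eval ((s : ℚ) / 3) * S.zγpow u uθ i τ.2 *
          S.qPart3 (Fin.snoc (u i) (uθ i)) s) = z ∧
      |z| ≤ M₃ * Xb ^ (∑ j, τ.2 j) * ((MonomialDen.monDen S.toQ.all (S.thirdBox Dbox Dθ s) : ℤ)) ^ 2 := by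
  obtain ⟨z₀, hz₀, hz₀le⟩ := hR
  obtain ⟨z₂, hz₂, hz₂le⟩ := S.exists_int_monDen_mul_qPart3 u uθ i hu huθ s
  set z₁ : ℤ := ∏ j, S.dirScalar (u i) (uθ i) j ^ τ.2 j with hz₁
  have hz₁q : ((S.bθ.natAbs ^ (∑ j, τ.2 j) : ℕ) : ℚ) * S.zγpow u uθ i τ.2 =
      (S.bθ.sign : ℚ) ^ (∑ j, τ.2 j) * z₁ := by
    have hsgn : ((S.bθ.natAbs : ℕ) : ℚ) = (S.bθ.sign : ℚ) * S.bθ := by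
      rw [Nat.cast_natAbs]; push_cast
      rw [← Int.cast_abs, ← Int.sign_mul_self_eq_abs]; push_cast; ring
    push_cast
    rw [hsgn, mul_pow, mul_assoc, S.bθ_pow_mul_zγpow, hz₁]
    push_cast; ring
  have hz₁le : |z₁| ≤ Xb ^ (∑ j, τ.2 j) := S.abs_prod_dirScalar_pow_le u uθ i τ.2 hX
  have hsgn1 : |(S.bθ.sign : ℤ) ^ (∑ j, τ.2 j)| = 1 := by
    rw [abs_pow]
    have : |S.bθ.sign| = 1 := by
      rcases lt_or_gt_of_ne S.bθ_ne with h | h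
      · rw [Int.sign_eq_neg_one_of_neg h]; rfl
      · rw [Int.sign_eq_one_of_pos h]; rfl
    rw [this, one_pow]
  refine ⟨z₀ * (S.bθ.sign ^ (∑ j, τ.2 j) * z₁) * z₂, ?_, ?_⟩
  · push_cast
    have e2 := hz₁q
    have e3 := hz₂
    push_cast at e2 e3
    calc ((den₃ : ℚ) * ((S.bθ.natAbs : ℕ) : ℚ) ^ (∑ j, τ.2 j) *
          (MonomialDen.monDen S.toQ.all (S.thirdBox Dbox Dθ s) : ℚ)) *
          ((hasseDeriv τ.1 (R i)).eval ((s : ℚ) / 3) * S.zγpow u uθ i τ.2 *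
            S.qPart3 (Fin.snoc (u i) (uθ i)) s)
        = ((den₃ : ℚ) * (hasseDeriv τ.1 (R i)).eval ((s : ℚ) / 3)) *
          ((((S.bθ.natAbs : ℕ) : ℚ) ^ (∑ j, τ.2 j)) * S.zγpow u uθ i τ.2) *
          ((MonomialDen.monDen S.toQ.all (S.thirdBox Dbox Dθ s) : ℚ) *
            S.qPart3 (Fin.snoc (u i) (uθ i)) s) := by ring
      _ = (z₀ : ℚ) * ((S.bθ.sign : ℚ) ^ (∑ j, τ.2 j) * z₁) * z₂ := by rw [hz₀, e2, e3]
  · have h0 : (0 : ℤ) ≤ M₃ := (abs_nonneg _).trans hz₀le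
    rw [abs_mul, abs_mul, abs_mul, hsgn1, one_mul]
    have hXb : (0 : ℤ) ≤ Xb ^ (∑ j, τ.2 j) := (abs_nonneg _).trans hz₁le
    calc |z₀| * |z₁| * |z₂| ≤ M₃ * Xb ^ (∑ j, τ.2 j) * |z₂| := by
          refine mul_le_mul_of_nonneg_right ?_ (abs_nonneg _)
          exact mul_le_mul hz₀le hz₁le (abs_nonneg _) h0
      _ ≤ M₃ * Xb ^ (∑ j, τ.2 j) * ((MonomialDen.monDen S.toQ.all (S.thirdBox Dbox Dθ s) : ℤ)) ^ 2 :=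
          mul_le_mul_of_nonneg_left hz₂le (mul_nonneg h0 hXb)

/-- **Every class sum cleared by the common denominator** `D = den₃·|b_θ|^{|t|}·monDen(all, thirdBox s)`:
`D·thirdVec r ∈ ℤ` with `|D·thirdVec r| ≤ #B_r·P·M₃·Xb^{|t|}·monDen²` (`B_r` = the unknowns of class `r` at `s`).
[cite: Yu2013, (5.35)–(5.39); shape only] -/
theorem exists_int_clear_mul_thirdVec {Dbox : Fin S.d → ℕ} {Dθ : ℕ} (B : Finset ι) (p : ι → ℤ)
    (hu : ∀ i ∈ B, ∀ j, |u i j| ≤ (Dbox j : ℤ)) (huθ : ∀ i ∈ B, |uθ i| ≤ (Dθ : ℤ))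
    (τ : Tau S.d) (s : ℤ) {den₃ : ℕ} {M₃ : ℤ}
    (hR : ∀ i ∈ B, ∃ z₀ : ℤ, (den₃ : ℚ) * (hasseDeriv τ.1 (R i)).eval ((s : ℚ) / 3) = z₀ ∧ |z₀| ≤ M₃)
    {Xb : ℤ} (hX : ∀ i ∈ B, ∀ j, |S.dirScalar (u i) (uθ i) j| ≤ Xb) {P : ℤ} (hP : ∀ i ∈ B, |p i| ≤ P)
    (r : Fin (S.d + 1) → Fin 3) :
    ∃ z : ℤ, ((den₃ * S.bθ.natAbs ^ (∑ j, τ.2 j) *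
        MonomialDen.monDen S.toQ.all (S.thirdBox Dbox Dθ s) : ℕ) : ℚ) * S.thirdVec R u uθ B p τ s r = z ∧
      |z| ≤ (B.filter (fun i => S.res3 (Fin.snoc (u i) (uθ i)) s = r)).card * P *
        (M₃ * Xb ^ (∑ j, τ.2 j) * ((MonomialDen.monDen S.toQ.all (S.thirdBox Dbox Dθ s) : ℤ)) ^ 2) := by
  classical
  set Br := B.filter (fun i => S.res3 (Fin.snoc (u i) (uθ i)) s = r) with hBr
  have hBrsub : ∀ i ∈ Br, i ∈ B := fun i hi => (Finset.mem_filter.mp hi).1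
  have hcoef : ∀ i ∈ Br, ∃ z : ℤ, ((den₃ * S.bθ.natAbs ^ (∑ j, τ.2 j) *
        MonomialDen.monDen S.toQ.all (S.thirdBox Dbox Dθ s) : ℕ) : ℚ) *
        ((hasseDeriv τ.1 (R i)).eval ((s : ℚ) / 3) * S.zγpow u uθ i τ.2 *
          S.qPart3 (Fin.snoc (u i) (uθ i)) s) = z ∧
      |z| ≤ M₃ * Xb ^ (∑ j, τ.2 j) * ((MonomialDen.monDen S.toQ.all (S.thirdBox Dbox Dθ s) : ℤ)) ^ 2 :=
    fun i hi => S.exists_int_clear_mul_third_coef R u uθ i (hu i (hBrsub i hi)) (huθ i (hBrsub i hi)) τ s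
      (hR i (hBrsub i hi)) (hX i (hBrsub i hi))
  choose! z hz hzle using hcoef
  refine ⟨∑ i ∈ Br, p i * z i, ?_, ?_⟩
  · unfold thirdVec
    rw [← hBr, Finset.mul_sum]
    push_cast
    refine Finset.sum_congr rfl fun i hi => ?_
    have h := hz i hi
    push_cast at h
    calc ((den₃ : ℚ) * ((S.bθ.natAbs : ℕ) : ℚ) ^ (∑ j, τ.2 j) *
          (MonomialDen.monDen S.toQ.all (S.thirdBox Dbox Dθ s) : ℚ)) *
          ((p i : ℚ) * ((hasseDeriv τ.1 (R i)).eval ((s : ℚ) / 3) * S.zγpow u uθ i τ.2 *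
            S.qPart3 (Fin.snoc (u i) (uθ i)) s))
        = (p i : ℚ) * (((den₃ : ℚ) * ((S.bθ.natAbs : ℕ) : ℚ) ^ (∑ j, τ.2 j) *
          (MonomialDen.monDen S.toQ.all (S.thirdBox Dbox Dθ s) : ℚ)) *
          ((hasseDeriv τ.1 (R i)).eval ((s : ℚ) / 3) * S.zγpow u uθ i τ.2 *
            S.qPart3 (Fin.snoc (u i) (uθ i)) s)) := by ring
      _ = (p i : ℚ) * (z i : ℚ) := by rw [h]
  · calc |∑ i ∈ Br, p i * z i| ≤ ∑ i ∈ Br, |p i * z i| := Finset.abs_sum_le_sum_abs _ _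
      _ ≤ ∑ i ∈ Br, P * (M₃ * Xb ^ (∑ j, τ.2 j) *
            ((MonomialDen.monDen S.toQ.all (S.thirdBox Dbox Dθ s) : ℤ)) ^ 2) := by
          refine Finset.sum_le_sum fun i hi => ?_
          rw [abs_mul]
          have hP0 : (0 : ℤ) ≤ P := (abs_nonneg _).trans (hP i (hBrsub i hi))
          exact mul_le_mul (hP i (hBrsub i hi)) (hzle i hi) (abs_nonneg _) hP0
      _ = Br.card * P * (M₃ * Xb ^ (∑ j, τ.2 j) *
            ((MonomialDen.monDen S.toQ.all (S.thirdBox Dbox Dθ s) : ℤ)) ^ 2) := by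
          rw [Finset.sum_const, nsmul_eq_mul]; ring

/-- **Size of the class vector**: `∑ᵣ |thirdVec r| ≤ #B·P·M₃·Xb^{|t|}·monDen(all, thirdBox s)²` (the classes
partition `B`; `den₃ ≥ 1`). [cite: Yu2013, (5.38); shape only] -/
theorem sum_abs_thirdVec_le {Dbox : Fin S.d → ℕ} {Dθ : ℕ} (B : Finset ι) (p : ι → ℤ)
    (hu : ∀ i ∈ B, ∀ j, |u i j| ≤ (Dbox j : ℤ)) (huθ : ∀ i ∈ B, |uθ i| ≤ (Dθ : ℤ))
    (τ : Tau S.d) (s : ℤ) {den₃ : ℕ} (hden₃ : 1 ≤ den₃) {M₃ : ℤ}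
    (hR : ∀ i ∈ B, ∃ z₀ : ℤ, (den₃ : ℚ) * (hasseDeriv τ.1 (R i)).eval ((s : ℚ) / 3) = z₀ ∧ |z₀| ≤ M₃)
    {Xb : ℤ} (hX : ∀ i ∈ B, ∀ j, |S.dirScalar (u i) (uθ i) j| ≤ Xb) {P : ℤ} (hP : ∀ i ∈ B, |p i| ≤ P) :
    ∑ r, |(S.thirdVec R u uθ B p τ s r : ℝ)| ≤
      (B.card : ℝ) * P * (M₃ * (Xb : ℝ) ^ (∑ j, τ.2 j) *
        ((MonomialDen.monDen S.toQ.all (S.thirdBox Dbox Dθ s) : ℝ)) ^ 2) := by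
  classical
  set Dn : ℕ := den₃ * S.bθ.natAbs ^ (∑ j, τ.2 j) * MonomialDen.monDen S.toQ.all (S.thirdBox Dbox Dθ s)
    with hDn
  have hb1 : 1 ≤ S.bθ.natAbs := Int.natAbs_pos.mpr S.bθ_ne
  have hmon1 : 1 ≤ MonomialDen.monDen S.toQ.all (S.thirdBox Dbox Dθ s) :=
    MonomialDen.one_le_monDen _ S.toQ.all_ne _
  have hDn1 : (1 : ℝ) ≤ Dn := by
    have : 1 ≤ Dn := one_le_mul (one_le_mul hden₃ (Nat.one_le_pow _ _ hb1)) hmon1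
    exact_mod_cast this
  set K : ℝ := (M₃ : ℝ) * (Xb : ℝ) ^ (∑ j, τ.2 j) *
    ((MonomialDen.monDen S.toQ.all (S.thirdBox Dbox Dθ s) : ℝ)) ^ 2 with hK
  have hl : ∀ r, |(S.thirdVec R u uθ B p τ s r : ℝ)| ≤
      ((B.filter (fun i => S.res3 (Fin.snoc (u i) (uθ i)) s = r)).card : ℝ) * P * K := by
    intro r
    obtain ⟨z, hz, hzle⟩ := S.exists_int_clear_mul_thirdVec R u uθ B p hu huθ τ s hR hX hP r
    have hzR : (Dn : ℝ) * (S.thirdVec R u uθ B p τ s r : ℝ) = (z : ℝ) := by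
      have := congrArg (fun q : ℚ => (q : ℝ)) hz
      push_cast at this ⊢
      rw [hDn]; push_cast
      exact this
    have hzle' : |(z : ℝ)| ≤ ((B.filter (fun i => S.res3 (Fin.snoc (u i) (uθ i)) s = r)).card : ℝ) * P * K := by
      have := (Int.cast_le (R := ℝ)).mpr hzle
      push_cast at this
      rw [hK]
      linarith
    calc |(S.thirdVec R u uθ B p τ s r : ℝ)| ≤ (Dn : ℝ) * |(S.thirdVec R u uθ B p τ s r : ℝ)| :=
          le_mul_of_one_le_left (abs_nonneg _) hDn1
      _ = |(z : ℝ)| := by rw [← hzR, abs_mul, Nat.abs_cast]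
      _ ≤ _ := hzle'
  have hpart : ∑ r : Fin (S.d + 1) → Fin 3,
      ((B.filter (fun i => S.res3 (Fin.snoc (u i) (uθ i)) s = r)).card : ℝ) = B.card := by
    have h := Finset.card_eq_sum_card_fiberwise (s := B) (t := (Finset.univ : Finset (Fin (S.d + 1) → Fin 3)))
      (f := fun i => S.res3 (Fin.snoc (u i) (uθ i)) s) (fun i _ => Finset.mem_univ _)
    rw [h]; push_cast; rfl
  calc ∑ r, |(S.thirdVec R u uθ B p τ s r : ℝ)|
      ≤ ∑ r, ((B.filter (fun i => S.res3 (Fin.snoc (u i) (uθ i)) s = r)).card : ℝ) * P * K :=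
        Finset.sum_le_sum fun r _ => hl r
    _ = (∑ r, ((B.filter (fun i => S.res3 (Fin.snoc (u i) (uθ i)) s = r)).card : ℝ)) * P * K := by
        rw [Finset.sum_mul, Finset.sum_mul]
    _ = (B.card : ℝ) * P * K := by rw [hpart]

end TwoSetup

end Summit.ABC.StewartYu

end
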